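import Mathlib.AlgebraicGeometry.Geometrically.Irreducible
import Mathlib.AlgebraicGeometry.PullbackCarrier
import Mathlib.AlgebraicGeometry.Pullbacks
import Mathlib.AlgebraicGeometry.Properties
import Mathlib.RingTheory.TensorProduct.MvPolynomial
import Summits.Ventures.HodgeRepro2.T6A2ProjSmooth

/-!
# T6A2ProjIrreducible — projective space is geometrically irreducible

Cell pub-hodge-repro2, Tier 6 (README §10), seat t6-p2 (A2 owner; gen 12, custodial). Piece (W-d) of the
non-vacuity record for DATA row 12 (README §10.5(ii)(c)): the structure morphism `ℙⁿ_k ⟶ Spec k` (host form,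
Varieties.lean ll. 40–44) is `GeometricallyIrreducible`, i.e. `ℙⁿ_k ×_k Spec K` is irreducible for every field
extension `K/k`. Proof: the base change is covered by the base changes of the charts `D₊(Xᵢ)`
(`Scheme.Pullback.openCoverOfLeft`); each is `Spec ((k[X]_{Xᵢ})₀ ⊗_k K) ≅ Spec K[Xⱼ/Xᵢ : j ≠ i]` (T6A2ProjChart +
`pullbackSpecIso` + `MvPolynomial.algebraTensorAlgEquiv`), the spectrum of a domain, hence irreducible; all
pieces contain a point over the generic point `(0)` of `ℙⁿ_k` (`Scheme.Pullback.exists_preimage_pullback`); and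
an open cover by irreducible opens with a common point is irreducible (`irreducibleSpace_of_openCover`).
Mathlib only; no display; no `sorry`; standard axioms.
§8(d): uses an L-value-free non-vanishing device: NO.
Filed in Tier-6 WAVE 1 (2026-08-26) as p438377 (definition lane, ACCEPTED 10:53Z, commit 07d612594b6b); this v2 differs from the filed bytes in this module docstring only (the staged-record wording dropped).
-/

namespace Summit.Ventures.HodgeRepro2.T6.A2Surface

open MvPolynomial HomogeneousLocalization AlgebraicGeometry CategoryTheory CategoryTheory.Limits
open scoped TensorProduct

attribute [local instance] MvPolynomial.gradedAlgebra

universe u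

section Gluing

/-- TOPOLOGICAL GLUING: a scheme with an open cover by irreducible pieces all of whose images contain a
common point is irreducible. -/
theorem irreducibleSpace_of_openCover {X : Scheme.{u}} (𝒰 : X.OpenCover)
    [∀ i, IrreducibleSpace (𝒰.X i)] (x : X) (hx : ∀ i, x ∈ Set.range (𝒰.f i)) :
    IrreducibleSpace X := by
  have hirr : ∀ i, IsPreirreducible (Set.range (𝒰.f i)) := fun i => by
    have := (IrreducibleSpace.isIrreducible_univ (𝒰.X i)).image (𝒰.f i)
      (𝒰.f i).continuous.continuousOn
    rw [Set.image_univ] at this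
    exact this.isPreirreducible
  haveI : PreirreducibleSpace X :=
    PreirreducibleSpace.of_forall_nonempty_inter fun U V hU hV ⟨u, hu⟩ ⟨v, hv⟩ => by
      obtain ⟨a, ua, rfl⟩ := 𝒰.exists_eq u
      obtain ⟨b, vb, rfl⟩ := 𝒰.exists_eq v
      obtain ⟨w, -, hwU, hwb⟩ := hirr a U (Set.range (𝒰.f b)) hU
        (IsOpenImmersion.isOpen_range (𝒰.f b)) ⟨_, ⟨ua, rfl⟩, hu⟩ ⟨x, hx a, hx b⟩
      obtain ⟨y, -, hyU, hyV⟩ := hirr b U V hU hV ⟨w, hwb, hwU⟩ ⟨_, ⟨vb, rfl⟩, hv⟩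
      exact ⟨y, hyU, hyV⟩
  exact @IrreducibleSpace.mk X _ inferInstance ⟨x⟩

end Gluing

section Generic

variable (k : Type u) [Field k] (n : ℕ)

/-- the generic point of `ℙⁿ_k = Proj k[X₀..Xₙ]`: the zero ideal (prime, homogeneous, relevant) -/
noncomputable def projGenericPoint : Proj (homogeneousSubmodule (Fin (n + 1)) k) :=
  ⟨⊥, Ideal.isPrime_bot, fun h => by
    have hmem : X 0 ∈ (⊥ : HomogeneousIdeal (homogeneousSubmodule (Fin (n + 1)) k)).toIdeal :=
      h (HomogeneousIdeal.mem_irrelevant_of_mem _ Nat.one_pos (X_mem_homogeneousSubmodule_one k 0))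
    rw [HomogeneousIdeal.toIdeal_bot, Ideal.mem_bot] at hmem
    exact X_ne_zero (0 : Fin (n + 1)) hmem⟩

/-- the generic point lies in every non-empty basic open `D₊(f)`, `f ≠ 0` -/
theorem projGenericPoint_mem_basicOpen (f : MvPolynomial (Fin (n + 1)) k) (hf : f ≠ 0) :
    projGenericPoint k n ∈ Proj.basicOpen (homogeneousSubmodule (Fin (n + 1)) k) f := by
  rw [Proj.mem_basicOpen]
  intro h
  have : f ∈ (⊥ : HomogeneousIdeal (homogeneousSubmodule (Fin (n + 1)) k)).toIdeal := h
  rw [HomogeneousIdeal.toIdeal_bot, Ideal.mem_bot] at this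
  exact hf this

end Generic

section BaseChange

variable (k : Type u) [Field k] (n : ℕ)

/-- the structure morphism of `ℙⁿ_k` in the host's form (Varieties.lean ll. 40–44) -/
noncomputable def projHom : Proj (homogeneousSubmodule (Fin (n + 1)) k) ⟶ Spec (CommRingCat.of k) :=
  Proj.toSpecZero (homogeneousSubmodule (Fin (n + 1)) k) ≫
    Spec.map (CommRingCat.ofHom (algebraMap k (homogeneousSubmodule (Fin (n + 1)) k 0)))

/-- on the chart `D₊(Xᵢ) = Spec (k[X]_{Xᵢ})₀`, the structure morphism is `Spec` of `k → (k[X]_{Xᵢ})₀` -/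
theorem awayι_comp_projHom (i : Fin (n + 1)) :
    Proj.awayι (homogeneousSubmodule (Fin (n + 1)) k) (X i) (X_mem_homogeneousSubmodule_one k i)
        Nat.one_pos ≫ projHom k n =
      Spec.map (CommRingCat.ofHom (chartAlgebraMap k i)) := by
  rw [projHom, Proj.awayι_toSpecZero_assoc, ← Spec.map_comp, ← CommRingCat.ofHom_comp]
  rfl

/-- the base change of a chart to `K` is `Spec K[Xⱼ/Xᵢ : j ≠ i]`, hence irreducible -/
theorem irreducibleSpace_pullback_chart (i : Fin (n + 1)) (K : Type u) [Field K] [Algebra k K] :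
    IrreducibleSpace ↥(pullback (Spec.map (CommRingCat.ofHom (chartAlgebraMap k i)))
      (Spec.map (CommRingCat.ofHom (algebraMap k K)))) := by
  letI : Algebra k (Away (homogeneousSubmodule (Fin (n + 1)) k) (X i)) :=
    (chartAlgebraMap k i).toAlgebra
  let e₁ : MvPolynomial {j : Fin (n + 1) // j ≠ i} k ≃ₐ[k]
      Away (homogeneousSubmodule (Fin (n + 1)) k) (X i) :=
    AlgEquiv.ofRingEquiv (f := chartEquiv k i) fun r =>
      DFunLike.congr_fun (chartEquiv_comp_algebraMap k i) r
  let e₂ : Away (homogeneousSubmodule (Fin (n + 1)) k) (X i) ⊗[k] K ≃+*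
      MvPolynomial {j : Fin (n + 1) // j ≠ i} K :=
    ((Algebra.TensorProduct.congr e₁.symm AlgEquiv.refl).trans
      (Algebra.TensorProduct.comm k _ K)).toRingEquiv.trans
      (MvPolynomial.algebraTensorAlgEquiv k K).toRingEquiv
  haveI : IsDomain (Away (homogeneousSubmodule (Fin (n + 1)) k) (X i) ⊗[k] K) :=
    MulEquiv.isDomain _ e₂.toMulEquiv
  exact ObjectProperty.prop_of_iso (C := Scheme.{u}) (IrreducibleSpace ·)
    (pullbackSpecIso k (Away (homogeneousSubmodule (Fin (n + 1)) k) (X i)) K).symm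
    (inferInstance : IrreducibleSpace
      (Spec (CommRingCat.of (Away (homogeneousSubmodule (Fin (n + 1)) k) (X i) ⊗[k] K))))

/-- the base change of the chart cover of `ℙⁿ_k` to `K` -/
noncomputable def projChartCoverBaseChange (K : Type u) [Field K] [Algebra k K] :
    (pullback (projHom k n) (Spec.map (CommRingCat.ofHom (algebraMap k K)))).OpenCover :=
  Scheme.Pullback.openCoverOfLeft (projChartCover k n).openCover (projHom k n)
    (Spec.map (CommRingCat.ofHom (algebraMap k K)))

/-- every piece of the base-changed chart cover is irreducible (it is the base change of a chart) -/
theorem irreducibleSpace_projChartCoverBaseChange_X (K : Type u) [Field K] [Algebra k K]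
    (j : Fin (n + 1)) : IrreducibleSpace ((projChartCoverBaseChange k n K).X j) := by
  show IrreducibleSpace ↥(pullback (Proj.awayι (homogeneousSubmodule (Fin (n + 1)) k) (X j)
    (X_mem_homogeneousSubmodule_one k j) Nat.one_pos ≫ projHom k n)
    (Spec.map (CommRingCat.ofHom (algebraMap k K))))
  rw [awayι_comp_projHom]
  exact irreducibleSpace_pullback_chart k n j K

/-- every piece of the base-changed chart cover contains a chosen point over the generic point -/
theorem mem_range_projChartCoverBaseChange_f (K : Type u) [Field K] [Algebra k K]
    (z : ↥(pullback (projHom k n) (Spec.map (CommRingCat.ofHom (algebraMap k K)))))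
    (hz : pullback.fst (projHom k n) (Spec.map (CommRingCat.ofHom (algebraMap k K))) z =
      projGenericPoint k n) (j : Fin (n + 1)) :
    z ∈ Set.range ((projChartCoverBaseChange k n K).f j) := by
  show z ∈ Set.range (pullback.map (Proj.awayι (homogeneousSubmodule (Fin (n + 1)) k) (X j)
    (X_mem_homogeneousSubmodule_one k j) Nat.one_pos ≫ projHom k n)
    (Spec.map (CommRingCat.ofHom (algebraMap k K))) (projHom k n)
    (Spec.map (CommRingCat.ofHom (algebraMap k K)))
    (Proj.awayι (homogeneousSubmodule (Fin (n + 1)) k) (X j) (X_mem_homogeneousSubmodule_one k j)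
      Nat.one_pos) (𝟙 _) (𝟙 _) (by simp) (by simp))
  rw [Scheme.Pullback.range_map]
  refine ⟨?_, ⟨pullback.snd (projHom k n) (Spec.map (CommRingCat.ofHom (algebraMap k K))) z, rfl⟩⟩
  show pullback.fst (projHom k n) (Spec.map (CommRingCat.ofHom (algebraMap k K))) z ∈
    Set.range (Proj.awayι (homogeneousSubmodule (Fin (n + 1)) k) (X j)
      (X_mem_homogeneousSubmodule_one k j) Nat.one_pos)
  rw [hz, ← Scheme.Hom.coe_opensRange, Proj.opensRange_awayι]
  exact projGenericPoint_mem_basicOpen k n (X j) (X_ne_zero j)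

/-- `ℙⁿ_k ×_k Spec K` is irreducible for every field extension `K/k` -/
theorem irreducibleSpace_pullback_projHom (K : Type u) [Field K] [Algebra k K] :
    IrreducibleSpace ↥(pullback (projHom k n) (Spec.map (CommRingCat.ofHom (algebraMap k K)))) := by
  haveI : ∀ i, IrreducibleSpace ((projChartCoverBaseChange k n K).X i) := fun i =>
    irreducibleSpace_projChartCoverBaseChange_X k n K i
  obtain ⟨y⟩ : Nonempty (Spec (CommRingCat.of K)) := inferInstance
  obtain ⟨z, hz₁, -⟩ := Scheme.Pullback.exists_preimage_pullback (f := projHom k n)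
    (g := Spec.map (CommRingCat.ofHom (algebraMap k K))) (projGenericPoint k n) y
    (Subsingleton.elim _ _)
  exact irreducibleSpace_of_openCover (projChartCoverBaseChange k n K) z fun i =>
    mem_range_projChartCoverBaseChange_f k n K z hz₁ i

/-- THE GEOMETRIC-IRREDUCIBILITY CLAUSE: the structure morphism of `ℙⁿ_k` (host form) is geometrically
irreducible. -/
theorem geometricallyIrreducible_projHom : GeometricallyIrreducible (projHom k n) := by
  rw [geometricallyIrreducible_iff, geometrically_iff_of_commRing_of_isClosedUnderIsomorphisms]
  intro K _ _
  exact irreducibleSpace_pullback_projHom k n K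

end BaseChange

end Summit.Ventures.HodgeRepro2.T6.A2Surface
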